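import Summits.MatrixMultiplication.MatrixMultiplication.Theorems.EdgePencilSixthMultiplicativity
import Literature.Computability.AlgebraicComplexity.DTensorStrassenPreorder
import Literature.Computability.AlgebraicComplexity.DTensorRankBridge
import HarnessLib


/-!
# The sixth-edge family in the asymptotic-restriction semiring `T₄(F)`, and the
# FLAT-SUMMAND PURCHASE `W_n^{(⌈n^δ⌉)} ≲ D_n ⊕ ⟨n⁴⟩` (definition and dual reading)

Support kernel for `stmt-MatrixMultiplication-26697` (`TetraExcessZero : ω(K₄) ≤ ω(2,1,2)`, the attacked
leaf of route `TetrahedronCarving`; cut of record `closes (TetraExcessZero) (TetraPlusTwo) : ω = 2`,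
UNCHANGED; lineage `decomp-mm-lens-6` «barrier-complement carving», generation 42; companion file
`EdgePencilFlatSummandPrice` proves the price theorem, the contrast and NEC). No item is added or changed.
NOTATION as in `EdgePencilSixthLadder` / `…Multiplicativity`: `W_n^{(e)} = sixTetra F n e` (the `K₄` graph
tensor with bond `e` on edge `01`), `D_n = W_n^{(1)}` the diamond (`sixTetra_one`), `T(K₄)_n = W_n^{(n)}`,
`χ = omegaSix`, `ψ = ω(2,1,2) = χ(0)`; the registered line `Cruxes/TetraExcessZero/Lines/rung_and_chord.lean`
has the stub `stub_sixRungPos : ∃ δ > 0, χ(δ) ≤ ψ` (RUNG).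

THE QUESTION. The lineage's negative knowledge on the rung side says: an ABSOLUTE certificate `χ(δ) ≤ 4`
is all-or-nothing (`absRung_iff_halfAlpha_and_sixRungPos`: it proves `α ≥ 1/2`), and RELATIVE certificates
of degeneration type `D_{n^μ} ⊠ A ⊵ W_n^{(n^δ)}` inherit the price of the catalyst and are block-dominated
(`rungCertificate_blockDominated`). Is there a relative certificate SHAPE whose price is provably not
inherited? This file places the family in the tree's semiring `T₄(F) = DTensorClass F 4` of 4-tensors
modulo restriction (Literature `DTensorSemiring`, `DTensorStrassenPreorder`: a Strassen-preordered
semiring, asymptotic preorder `≲ = AsympLe (· ≤ ·)`, spectral theorem `asympLe_iff_forall_mem_spectrum`)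
and types the answer — a FLAT SUMMAND; `EdgePencilFlatSummandPrice.sixRung_of_flatPurchase` proves it.

* §0 two Literature-level helpers (leg-wise precomposition is a restriction; `R(a + b) ≤ R(a) + R(b)`).
* §1 THE FAMILY IN `T₄(F)`. The Kronecker product in the bond is a CLASS EQUALITY
  `[W_N^{(e₁)}]·[W_M^{(e₂)}] = [W_{N·M}^{(e₁e₂)}]` (`mk_sixTetra_mul`, `e₁ ≤ N`, `e₂ ≤ M`: both sides are
  leg-wise bijective pullbacks of each other, `sixKron_eq_pullback_inv`; the tree had the RANK equality
  `tensorRankD_sixKron_eq` only), hence `[W_n^{(e)}]^k = [W_{n^k}^{(e^k)}]` (`mk_sixTetra_pow`); bond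
  monotonicity `[W^{(e)}] ≤ [W^{(e')}]` (`mk_sixTetra_mono`); the abstract rank of `T₄(F)` at `[W]` is
  `R₄(W)` (`rankOf_mk_sixTetra`).
* §2 THE FLAT-SUMMAND PURCHASE `RUNG♭(δ, n) : [W_n^{(⌈n^δ⌉)}] ≲ [D_n] + n⁴` — asymptotic
  restriction from the diamond plus the unit tensor `⟨n⁴⟩`; unfolded, `W_{n^k}^{(⌈n^δ⌉^k)}` is a
  restriction of `2^{o(k)} · ⊕_j binom(k,j)·n^{4(k−j)}` copies of `D_{n^j}` — a GRADED diamond cover in which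
  the level-`n^j` diamonds come with multiplicity `n^{4(k−j)}` (contrast the block-dominated single-level
  covers of `rungCertificate_blockDominated`). DUAL READING (`flatPurchase_iff_spectrum`): every point `φ`
  of the asymptotic spectrum of 4-tensors has `φ[W_n^{(⌈n^δ⌉)}] ≤ φ[D_n] + n⁴` — the points that value the
  diamond cheaply must value the thinned tetrahedron at most `n⁴`. Bottom `δ ≤ 0` trivial
  (`flatPurchase_of_nonpos`); antitone in `δ` (`flatPurchase_anti`); implied by the absolute purchase.

STATUS of the purchase as a target (memo NODE-g42 of the lineage): it passes every recorded law-level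
screen (all gauge points, all 4-party quantum functionals, the grouping pullbacks for `δ ≤ 2α`); it is
implied by `TetraFlat` (`EdgePencilFlatSummandPrice.flatPurchase_of_tetraFlat`) and implies the rung; at
`δ = 1` it is `TetraFlat` itself by the `Aut(K₄)`-symmetry of `T(K₄)` (informal), so the honest target is
SMALL `δ > 0`. It is UNDECIDED by the recorded laws: a 4-party spectral point with
`φ[W_n^{(⌈n^δ⌉)}] > φ[D_n] + n⁴` kills it; a degeneration `(D_n ⊕ ⟨n⁴⟩)^{⊠k} ⊵ 2^{-o(k)}(W_n^{(⌈n^δ⌉)})^{⊠k}`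
proves it. The purchase is a SHAPE OF HYPOTHESIS / typed target, spelled out as the displayed `AsympLe` in
every statement (no definition, no item): nothing is claimed about which `(δ, n)` satisfy it beyond §2 and
the companion file.

References: Strassen 1988 (asymptotic spectrum, spectral theorem) [Strassen1988]; Zuiddam 2018, §2.1,
§2.8, Thm. 2.12 [Zuiddam2018]; Christandl–Vrana–Zuiddam 2023, Thm. 1.1, §1.1–1.2
[ChristandlVranaZuiddam2023]; Christandl–Vrana–Zuiddam, arXiv:1609.07476, §1.1, Prop. 1.1.16 (graph tensors
with non-uniform bonds multiply edge-wise) [ChristandlVranaZuiddam2016]; Bürgisser–Clausen–Shokrollahi,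
§15.6 pp. 426–427 (direct-sum decompositions) [BurgisserClausenShokrollahi1997].
No `sorry`, no new axiom, no instance, no notation, no definition.
-/

noncomputable section

set_option linter.dupNamespace false

open Filter Asymptotics Finset Literature.Computability.AlgebraicComplexity
open Summit.MatrixMultiplication.MatrixMultiplication.Theorems.TetrahedronTensor
open Summit.MatrixMultiplication.MatrixMultiplication.Theorems.TetraDiagonal
open Summit.MatrixMultiplication.MatrixMultiplication.Theses.TetrahedronCarving

namespace Summit.MatrixMultiplication.MatrixMultiplication.Theorems.EdgePencil

/-! ## §0 Helpers on the Literature side -/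

section Helpers

/-- **Leg-wise precomposition is a restriction**: `t ≥ (i ↦ t (j ↦ f_j (i j)))` for any family of maps of
index sets `f_j : κ → ι`, one per leg (act by the transposed matrices `[b = f_j a]`; the tree's
`DTensor.restricts_precomp` is the case of one `f` for all legs). [cite: ChristandlVranaZuiddam2023, §1.1] -/
theorem restricts_precomp_legwise {K : Type*} [CommSemiring K] {d : ℕ} {ι κ : Type*} [Fintype ι]
    [DecidableEq ι] (f : Fin d → κ → ι) (t : (Fin d → ι) → K) :
    DTensor.Restricts t (fun i : Fin d → κ => t (fun j => f j (i j))) := by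
  refine ⟨fun j (a : κ) (b : ι) => if b = f j a then (1 : K) else 0, ?_⟩
  funext i
  rw [DTensor.apply_apply_eq]
  simp_rw [DTensor.prod_ite_eq_eq _ (fun j => f j (i j))]
  rw [Finset.sum_ite_eq' Finset.univ]
  simp

/-- **Leg-wise bijective relabelling does not change the class**: if each `f_j` has a section `g_j`
(`f_j ∘ g_j = id`), then `[i ↦ t (j ↦ f_j (i j))] = [t]` in `T_d(K)`.
[cite: ChristandlVranaZuiddam2023, §1.2] -/
theorem mk_precomp_legwise_eq {K : Type*} [CommSemiring K] {d : ℕ} {ι κ : Type*} [Fintype ι]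
    [Fintype κ] [DecidableEq ι] [DecidableEq κ] (f : Fin d → κ → ι) (g : Fin d → ι → κ)
    (hfg : ∀ j a, f j (g j a) = a) (t : (Fin d → ι) → K) :
    DTensorClass.mk (fun i : Fin d → κ => t (fun j => f j (i j))) = DTensorClass.mk t := by
  refine DTensorClass.mk_eq_mk (restricts_precomp_legwise f t) ?_
  have h := restricts_precomp_legwise g (fun i : Fin d → κ => t (fun j => f j (i j)))
  simp only [hfg] at h
  exact h

/-- **`R(a + b) ≤ R(a) + R(b)`** in a Strassen-preordered semiring. [cite: Zuiddam2018, §2.8] -/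
theorem rankOf_add_le {S : Type*} [CommSemiring S] {le : S → S → Prop} (h : IsStrassenPreorder le)
    (a b : S) : rankOf le (a + b) ≤ rankOf le a + rankOf le b := by
  refine IsStrassenPreorder.rankOf_le_of_le ?_
  rw [Nat.cast_add]
  exact h.add_le_add (h.le_rankOf a) (h.le_rankOf b)

end Helpers

/-! ## §1 The sixth-edge family in `T₄(F)` -/

section Classes

variable {F : Type*} [Field F]

/-- The inverse of the label splitting `x ↦ (K₁ x, K₂ x)` at the product level `N·M`. -/
theorem K₁_K₂_section {N M : ℕ} (p : Fin (N ^ 3) × Fin (M ^ 3)) :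
    (K₁ (finFunctionFinEquiv fun j => finProdFinEquiv
        (finFunctionFinEquiv.symm p.1 j, finFunctionFinEquiv.symm p.2 j) : Fin ((N * M) ^ 3)),
      K₂ (finFunctionFinEquiv fun j => finProdFinEquiv
        (finFunctionFinEquiv.symm p.1 j, finFunctionFinEquiv.symm p.2 j) : Fin ((N * M) ^ 3))) = p := by
  obtain ⟨p₁, p₂⟩ := p
  simp [K₁, K₂]

/-- **The level-`N·M` pointwise product is the class product**: `[i ↦ A(K₁ ∘ i)·B(K₂ ∘ i)] = [A]·[B]`
in `T₄(F)` (the label splitting is a bijection `Fin ((NM)³) ≃ Fin (N³) × Fin (M³)` on every leg).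
[cite: ChristandlVranaZuiddam2023, §1.2] -/
theorem mk_mulK_eq {N M : ℕ} (A : (Fin 4 → Fin (N ^ 3)) → F) (B : (Fin 4 → Fin (M ^ 3)) → F) :
    DTensorClass.mk (fun i : Fin 4 → Fin ((N * M) ^ 3) =>
        A (fun v => K₁ (i v)) * B (fun v => K₂ (i v))) =
      DTensorClass.mk A * DTensorClass.mk B := by
  classical
  rw [DTensorClass.mk_mul_mk]
  exact mk_precomp_legwise_eq (K := F) (d := 4)
    (fun _ (x : Fin ((N * M) ^ 3)) => ((K₁ x, K₂ x) : Fin (N ^ 3) × Fin (M ^ 3)))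
    (fun _ (p : Fin (N ^ 3) × Fin (M ^ 3)) => (finFunctionFinEquiv fun j => finProdFinEquiv
        (finFunctionFinEquiv.symm p.1 j, finFunctionFinEquiv.symm p.2 j) : Fin ((N * M) ^ 3)))
    (fun _ p => K₁_K₂_section p) (DTensor.kron A B)

/-- **Relabelling edge `01` does not change the class** (`relab₀₁ σ` is invertible leg-wise,
`relab₀₁_relab₀₁_inv`). [cite: ChristandlVranaZuiddam2023, §1.2] -/
theorem mk_relab₀₁_eq {n : ℕ} (σ : Equiv.Perm (Fin n)) (t : (Fin 4 → Fin (n ^ 3)) → F) :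
    DTensorClass.mk (fun x : Fin 4 → Fin (n ^ 3) => t (fun v => relab₀₁ σ v (x v))) =
      DTensorClass.mk t :=
  mk_precomp_legwise_eq (fun v => relab₀₁ σ v) (fun v => relab₀₁ σ⁻¹ v)
    (fun v x => relab₀₁_relab₀₁_inv σ v x) t

/-- **Kronecker in the bond, as a CLASS EQUALITY in `T₄(F)`**:
`[W_N^{(e₁)}] · [W_M^{(e₂)}] = [W_{N·M}^{(e₁e₂)}]` for `e₁ ≤ N`, `e₂ ≤ M` (the tree's rank equality
`tensorRankD_sixKron_eq`, upgraded from ranks to restriction classes).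
[cite: ChristandlVranaZuiddam2016, §1.1 (graph tensors multiply under ⊠)] -/
theorem mk_sixTetra_mul {N M e₁ e₂ : ℕ} (h₁ : e₁ ≤ N) (h₂ : e₂ ≤ M) :
    DTensorClass.mk (sixTetra F N e₁) * DTensorClass.mk (sixTetra F M e₂) =
      DTensorClass.mk (sixTetra F (N * M) (e₁ * e₂)) := by
  classical
  obtain ⟨σ, hσ⟩ := exists_perm_box h₁ h₂
  rw [← mk_mulK_eq, sixKron_eq_pullback_inv (F := F) σ hσ, mk_relab₀₁_eq]

/-- Index transport: equal levels and bonds give equal classes. [folklore] -/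
theorem mk_sixTetra_congr {N N' e e' : ℕ} (hN : N = N') (he : e = e') :
    DTensorClass.mk (sixTetra F N e) = DTensorClass.mk (sixTetra F N' e') := by
  subst hN
  subst he
  rfl

/-- **Powers are levels**: `[W_n^{(e)}]^{k+1} = [W_{n^{k+1}}^{(e^{k+1})}]` (`e ≤ n`).
[cite: ChristandlVranaZuiddam2016, Prop. 1.1.16 (proof)] -/
theorem mk_sixTetra_pow {n e : ℕ} (he : e ≤ n) (k : ℕ) :
    DTensorClass.mk (sixTetra F n e) ^ (k + 1) =
      DTensorClass.mk (sixTetra F (n ^ (k + 1)) (e ^ (k + 1))) := by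
  induction k with
  | zero =>
    rw [zero_add, pow_one]
    exact mk_sixTetra_congr (pow_one n).symm (pow_one e).symm
  | succ k ih =>
    rw [pow_succ, ih, mk_sixTetra_mul (Nat.pow_le_pow_left he _) he, ← pow_succ, ← pow_succ]

/-- **Leg multiplication is a restriction in `T₄(F)`**: `[i ↦ (∏_v L_v(i_v)) · t i] ≤ [t]` (act by the
diagonal matrices `diag(L_v)`). [cite: ChristandlVranaZuiddam2023, §1.1] -/
theorem mk_legMul_le {n : ℕ} (L : Fin 4 → Fin (n ^ 3) → F) (t : (Fin 4 → Fin (n ^ 3)) → F) :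
    DTensorClass.mk (fun i : Fin 4 → Fin (n ^ 3) => (∏ v, L v (i v)) * t i) ≤ DTensorClass.mk t := by
  classical
  rw [DTensorClass.mk_le_mk_iff]
  refine ⟨fun v (a : Fin (n ^ 3)) (b : Fin (n ^ 3)) => if b = a then L v a else 0, ?_⟩
  funext i
  rw [DTensor.apply_apply_eq]
  have h : ∀ k : Fin 4 → Fin (n ^ 3),
      (∏ j, (if k j = i j then L j (i j) else 0)) * t k =
        if k = i then (∏ v, L v (i v)) * t k else 0 := by
    intro k
    by_cases hk : k = i
    · subst hk
      simp
    · obtain ⟨j, hj⟩ := Function.ne_iff.1 hk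
      rw [Finset.prod_eq_zero (Finset.mem_univ j) (if_neg hj), zero_mul, if_neg hk]
  simp_rw [h]
  rw [Finset.sum_ite_eq' Finset.univ i]
  simp

/-- **Bond monotonicity in `T₄(F)`**: `[W_n^{(e)}] ≤ [W_n^{(e')}]` for `e ≤ e'` (in particular
`[D_n] ≤ [W_n^{(e)}] ≤ [T(K₄)_n]`). [folklore] -/
theorem mk_sixTetra_mono {n e e' : ℕ} (h : e ≤ e') :
    DTensorClass.mk (sixTetra F n e) ≤ DTensorClass.mk (sixTetra F n e') := by
  rw [sixTetra_eq_legMul_sixTetra (F := F) (n := n) h]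
  exact mk_legMul_le _ _

/-- **The abstract rank of `T₄(F)` at `[W_n^{(e)}]` is `R₄(W_n^{(e)})`.**
[cite: ChristandlVranaZuiddam2023, §1.1] -/
theorem rankOf_mk_sixTetra (n e : ℕ) :
    rankOf (fun x y : DTensorClass F 4 => x ≤ y) (DTensorClass.mk (sixTetra F n e)) =
      tensorRankD (sixTetra F n e) :=
  DTensorClass.rankOf_mk_eq_tensorRankD _

/-- `⌈(n^k)^δ⌉ ≤ ⌈n^δ⌉^k` (`δ ≥ 0`). [folklore] -/
theorem rectDim_pow_le (n k : ℕ) (δ : ℝ) : rectDim (n ^ k) δ ≤ rectDim n δ ^ k := by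
  have hn0 : (0 : ℝ) ≤ n := Nat.cast_nonneg n
  unfold rectDim
  refine Nat.ceil_le.2 ?_
  push_cast
  rw [← Real.rpow_natCast_mul hn0, mul_comm, Real.rpow_mul_natCast hn0]
  exact pow_le_pow_left₀ (Real.rpow_nonneg hn0 δ) (Nat.le_ceil _) k

end Classes

/-! ## §2 The flat-summand purchase and its dual reading -/

section Purchase

variable (F : Type) [Field F]

/-! **The flat-summand purchase `RUNG♭(δ)` at level `n`** is the displayed asymptotic inequality
`AsympLe (· ≤ ·) [W_n^{(⌈n^δ⌉)}] ([D_n] + n⁴)` in `T₄(F)` — the thinned tetrahedron is an ASYMPTOTIC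
RESTRICTION of the diamond plus the unit tensor `⟨n⁴⟩` (`D_n = W_n^{(1)}`, `sixTetra_one`; `≲ = AsympLe`:
`[W]^k ≤ 2^{o(k)}·([D_n] + n⁴)^k` for all `k`). It is spelled out in every statement below (a typed TARGET
for an upper-side mechanism; no definition, no item). [cite: Zuiddam2018, Def. 2.1] -/

/-- **Dual reading** (Strassen's spectral theorem, `asympLe_iff_forall_mem_spectrum`): the purchase holds
iff EVERY point `φ` of the asymptotic spectrum of 4-tensors has `φ[W_n^{(⌈n^δ⌉)}] ≤ φ[D_n] + n⁴`.
[cite: ChristandlVranaZuiddam2023, Thm. 1.1] -/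
theorem flatPurchase_iff_spectrum (δ : ℝ) (n : ℕ) :
    AsympLe (fun x y : DTensorClass F 4 => x ≤ y) (DTensorClass.mk (sixTetra F n (rectDim n δ)))
      (DTensorClass.mk (sixTetra F n 1) + ((n ^ 4 : ℕ) : DTensorClass F 4)) ↔
      ∀ φ ∈ DTensorClass.asymptoticSpectrumDTensors F 2,
        φ (DTensorClass.mk (sixTetra F n (rectDim n δ))) ≤
          φ (DTensorClass.mk (sixTetra F n 1)) + (n : ℝ) ^ 4 := by
  rw [DTensorClass.asympLe_iff_forall_mem_spectrum]
  refine forall₂_congr fun φ hφ => ?_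
  have hφ' := DTensorClass.mem_asymptoticSpectrumDTensors_iff.1 hφ
  rw [hφ'.map_add, hφ'.map_natCast]
  push_cast
  exact Iff.rfl

/-- **Bottom**: for `δ ≤ 0` the purchase is trivial (`⌈n^δ⌉ = 1`, `W = D_n ≤ D_n ⊕ ⟨n⁴⟩`). [folklore] -/
theorem flatPurchase_of_nonpos {δ : ℝ} (hδ : δ ≤ 0) {n : ℕ} (hn : 1 ≤ n) :
    AsympLe (fun x y : DTensorClass F 4 => x ≤ y) (DTensorClass.mk (sixTetra F n (rectDim n δ)))
      (DTensorClass.mk (sixTetra F n 1) + ((n ^ 4 : ℕ) : DTensorClass F 4)) := by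
  have hSP : IsStrassenPreorder (fun x y : DTensorClass F 4 => x ≤ y) :=
    DTensorClass.isStrassenPreorder F 2
  have hd : rectDim n δ = 1 :=
    le_antisymm (by simpa using rectDim_mono hn hδ) (one_le_rectDim hn δ)
  rw [hd]
  exact hSP.asympLe_of_le (hSP.le_add_right _ _)

/-- **Antitone in `δ`**: a purchase at `δ` is a purchase at every `δ' ≤ δ` (bond monotonicity). [folklore] -/
theorem flatPurchase_anti {δ δ' : ℝ} (h : δ' ≤ δ) {n : ℕ} (hn : 1 ≤ n)
    (hP : AsympLe (fun x y : DTensorClass F 4 => x ≤ y) (DTensorClass.mk (sixTetra F n (rectDim n δ)))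
        (DTensorClass.mk (sixTetra F n 1) + ((n ^ 4 : ℕ) : DTensorClass F 4))) :
    AsympLe (fun x y : DTensorClass F 4 => x ≤ y) (DTensorClass.mk (sixTetra F n (rectDim n δ')))
      (DTensorClass.mk (sixTetra F n 1) + ((n ^ 4 : ℕ) : DTensorClass F 4)) := by
  have hSP : IsStrassenPreorder (fun x y : DTensorClass F 4 => x ≤ y) :=
    DTensorClass.isStrassenPreorder F 2
  exact hSP.asympLe_trans (hSP.asympLe_of_le (mk_sixTetra_mono (rectDim_mono hn h))) hP

/-- An absolute purchase `[W] ≲ n⁴` is a flat-summand purchase. [folklore] -/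
theorem flatPurchase_of_absolute {δ : ℝ} {n : ℕ}
    (h : AsympLe (fun x y : DTensorClass F 4 => x ≤ y)
      (DTensorClass.mk (sixTetra F n (rectDim n δ))) ((n ^ 4 : ℕ) : DTensorClass F 4)) :
    AsympLe (fun x y : DTensorClass F 4 => x ≤ y) (DTensorClass.mk (sixTetra F n (rectDim n δ)))
      (DTensorClass.mk (sixTetra F n 1) + ((n ^ 4 : ℕ) : DTensorClass F 4)) := by
  have hSP : IsStrassenPreorder (fun x y : DTensorClass F 4 => x ≤ y) :=
    DTensorClass.isStrassenPreorder F 2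
  exact hSP.asympLe_trans h (hSP.asympLe_of_le (hSP.le_add_left _ _))

end Purchase

end Summit.MatrixMultiplication.MatrixMultiplication.Theorems.EdgePencil

end
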